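import Summits.KontsevichZagierPeriods.KontsevichZagierPeriods.Theorems.LinRedNormalFormArrangementNormalFormStubRebaseSimpleZeroNestedDiffE1Core
import Summits.KontsevichZagierPeriods.KontsevichZagierPeriods.Theorems.LinRedNormalFormArrangementNormalFormStubRebaseSimpleZeroNestedDiffE1VertexPole

/-!
# Stub `stub_rebaseSimpleZeroTwo`, part `rebaseSimpleZero_HDiff1_of_HPar1` (crux
`ArrangementNormalForm`, line `janus-bands`) — assembly `NestedDiffE1Final`

**The interval normal form `HDiff₁` from the two residual hypotheses of TYPE S.** The residual
pole hypothesis `RebaseE1.HPoleLS` of the assembly `NestedDiffE1Core` (pinch vertex carrying the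
base pole, not both letters) is split by the positions of the letters and of the four directions at
the vertex (`A'`, `B'`, the horizontal `0` of the inner letter, the slope `λ` of the outer letter):
* letters off the vertex: `A' > 0` and `λ > B'` are the brick `NestedDiffE1VertexPole`
  (`good_vtx_pole_up` / `good_vtx_pole_par`), `A' = 0` and `λ = B'` are `HPar1`, a direction
  through the vertex INSIDE the band (`A' < 0 < B'` or `A' < λ < B'`) is first cut away by the
  three-piece dissection (`IsDN.good_cut`; the other piece is `HPar1`); what is left is TYPE S,
  `λ ≤ A' < B' ≤ 0` (the band between the outer-letter direction below and the horizontal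
  above) — the hypothesis `RebaseE1.HTypeSLS`;
* exactly one letter through the vertex (and the pole at it) — the hypothesis `RebaseE1.HPole1LS`.
So `HDiff₁` holds for every datum given `HPole1LS` and `HTypeSLS` for its letter data and for the
base-reflected letter data (`RebaseE1.IsDN.good_of_typeS`, registered as
`rebaseSimpleZero_E1ofTypeS`); literal forms `rebaseSimpleZero_HDiff1_of_HPole1S` and the
stub-format closure `rebaseSimpleZeroTwo_of_HPole1S`.

Members of the two residues: `HTypeS`: `[{0<y<1, −2y<t₁<t₂<−y}, 1/(y (t₁−1)(t₂+3y+1))]`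
(suggested route: rule (1b) expansion of the outer letter about `r`, letter piece by
`RebaseDiff.good_any`, frame piece in the frame `base := tⱼ`); `HPole1`:
`[{0<y<1, y<t₁<t₂<2y}, 1/(y t₁ (t₂−3y−1))]` (suggested route: the pinch-vertex blow-up of
`rebaseSimpleZero_nestedBlowUp` after the shear `t ↦ t − 3y`, radial fibre `tⱼ`).

References: M. Kontsevich, D. Zagier, *Periods* (2001), §1.2, rules (1a), (1b), (2).
-/

noncomputable section

open Set MeasureTheory MvPolynomial
open Literature.NumberTheory.Transcendental Literature.ModelTheory.ExponentialFields

namespace Summit.KontsevichZagierPeriods.ArrangementNormalForm.JanusBands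

namespace RebaseE1

open SeparatePos RebasePos RebaseZero RebaseNest RebaseDiff

variable {i j : Fin 2} {s : KZ.IntegralRep (0 + 1 + 2)} {l u : ℚ} {A B : Cf} {T : BData}
  {p : MvPolynomial (Fin 0) ℚ} {a : Fin 2 → Option Cf} {ci cj : Cf}

/-- **Residual hypothesis `HPole1` on structured data**: a pinch at the left end whose vertex
carries the base pole and EXACTLY ONE letter, regular right end, is good for `GG 0 2 2`.
[Kontsevich–Zagier 2001, §1.2] -/
def HPole1LS (T : BData) (p : MvPolynomial (Fin 0) ℚ) (a : Fin 2 → Option Cf) (i j : Fin 2) (ci cj : Cf) : Prop :=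
  ∀ (s : KZ.IntegralRep (0 + 1 + 2)) (l u : ℚ) (A B : Cf), IsDN s l u A B T p a i j → Kc T p ≠ 0 →
    evq A l = evq B l → T.ℓ₂.2 = l →
    ((ci.2 = evq A l ∧ evq cj l ≠ evq A l) ∨ (ci.2 ≠ evq A l ∧ evq cj l = evq A l)) → evq A u < evq B u →
    Good 2 (KZ.of s)

/-- **Residual hypothesis `HTypeS` on structured data**: a pinch at the left end whose vertex
carries the base pole and no letter, the band lying between the outer-letter direction below and
the horizontal above (`λ ≤ A' < B' ≤ 0`), regular right end, is good for `GG 0 2 2`.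
[Kontsevich–Zagier 2001, §1.2] -/
def HTypeSLS (T : BData) (p : MvPolynomial (Fin 0) ℚ) (a : Fin 2 → Option Cf) (i j : Fin 2) (ci cj : Cf) : Prop :=
  ∀ (s : KZ.IntegralRep (0 + 1 + 2)) (l u : ℚ) (A B : Cf), IsDN s l u A B T p a i j → Kc T p ≠ 0 →
    evq A l = evq B l → T.ℓ₂.2 = l → ci.2 ≠ evq A l → evq cj l ≠ evq A l →
    cj.1 (Fin.last 0) ≤ A.1 (Fin.last 0) → B.1 (Fin.last 0) ≤ 0 → evq A u < evq B u → Good 2 (KZ.of s)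

/-- Rational evaluation of `mk` at `l`. -/
theorem evq_mk (α c l : ℚ) : evq (RebaseZero.mk α c) l = α * l + c := by rw [evq, mk_fst, mk_snd]

/-- **Pole at the vertex, letters off, band weakly below the horizontal** (`B' ≤ 0`): `λ > B'` is
`good_vtx_pole_par`, `λ = B'` is `HPar1`, `A' < λ < B'` is cut at the `cⱼ`-parallel section
through the vertex (lower piece `HPar1`, upper piece type S), `λ ≤ A'` is type S.
[Kontsevich–Zagier 2001, §1.2, rule (1a)] -/
theorem IsDN.good_vtx_pole_low (h : IsDN s l u A B T p a i j) (hL : LData T a i j ci cj)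
    (hP : HParS T p a i j ci cj) (hK : Kc T p ≠ 0) (hpinch : evq A l = evq B l) (hpole : T.ℓ₂.2 = l)
    (hci : ci.2 ≠ evq A l) (hcj : evq cj l ≠ evq A l) (hβ : B.1 (Fin.last 0) ≤ 0) (hreg : evq A u < evq B u)
    (hS : HTypeSLS T p a i j ci cj) : Good 2 (KZ.of s) := by
  have hadm : T.n₁ = 0 ∨ T.n₂ = 0 := Or.inl hL.n1
  rcases lt_trichotomy (cj.1 (Fin.last 0)) (B.1 (Fin.last 0)) with hlt | heq | hgt
  · by_cases hla : cj.1 (Fin.last 0) ≤ A.1 (Fin.last 0)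
    · exact hS s l u A B h hK hpinch hpole hci hcj hla hβ hreg
    · push Not at hla
      -- `A' < λ < B'`: cut at the `cⱼ`-parallel section through the vertex
      set t₀ : ℚ := evq A l with ht₀
      set lam : ℚ := cj.1 (Fin.last 0) with hlamdef
      set Y : Cf := RebaseZero.mk lam (t₀ - lam * l) with hY
      have hYl : evq Y l = t₀ := by rw [hY, evq_mk]; ring
      have hYv : ∀ y : ℝ, ev Y y = t₀ + lam * (y - l) := fun y => by rw [hY, ev_mk]; push_cast; ring
      have hA : ∀ y : ℝ, ev A y = t₀ + A.1 (Fin.last 0) * (y - l) := fun y => by rw [ev_pinch A l]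
      have hB : ∀ y : ℝ, ev B y = t₀ + B.1 (Fin.last 0) * (y - l) := fun y => by rw [ev_pinch B l, ← hpinch]
      have hla' : (A.1 (Fin.last 0) : ℝ) < lam := by exact_mod_cast hla
      have hlt' : (lam : ℝ) < B.1 (Fin.last 0) := by exact_mod_cast hlt
      refine h.good_cut hadm Y (fun y h1 _ => by rw [hA, hYv]; nlinarith) (fun y h1 _ => by rw [hYv, hB]; nlinarith)
        (fun s₁ h₁ => h₁.good_par hP (Or.inr (by rw [hY, mk_fst]))) fun s₃ h₃ => ?_
      have hu : (l : ℝ) < u := by exact_mod_cast h.lu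
      have hregY : evq Y u < evq B u := by
        have key : ev Y u < ev B u := by rw [hYv, hB]; nlinarith
        rw [ev_ratCast, ev_ratCast] at key
        exact_mod_cast key
      exact hS s₃ l u Y B h₃ hK (hYl.trans hpinch) hpole (by rw [hYl]; exact hci) (by rw [hYl]; exact hcj)
        (by rw [hY, mk_fst]) hβ hregY
  · exact h.good_par hP (Or.inr heq.symm)
  · exact h.good_vtx_pole_par hL hP hK hpinch hpole hci hcj hgt hreg

/-- **Pole at the vertex, not both letters through it**: exactly one letter through the vertex is
`HPole1`; letters off: `A' > 0` is `good_vtx_pole_up`, `A' = 0` is `HPar1`, `A' < 0 < B'` is cut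
at the constant `t₀` through the vertex (upper piece `HPar1`, lower piece `good_vtx_pole_low`),
`B' ≤ 0` is `good_vtx_pole_low`. [Kontsevich–Zagier 2001, §1.2, rule (1a)] -/
theorem IsDN.good_vtx_pole (h : IsDN s l u A B T p a i j) (hL : LData T a i j ci cj)
    (hP : HParS T p a i j ci cj) (hK : Kc T p ≠ 0) (hpinch : evq A l = evq B l) (hpole : T.ℓ₂.2 = l)
    (hnb : ¬ (ci.2 = evq A l ∧ evq cj l = evq A l)) (hreg : evq A u < evq B u)
    (h1 : HPole1LS T p a i j ci cj) (hS : HTypeSLS T p a i j ci cj) : Good 2 (KZ.of s) := by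
  have hadm : T.n₁ = 0 ∨ T.n₂ = 0 := Or.inl hL.n1
  by_cases hi : ci.2 = evq A l
  · exact h1 s l u A B h hK hpinch hpole (Or.inl ⟨hi, fun hj => hnb ⟨hi, hj⟩⟩) hreg
  by_cases hj : evq cj l = evq A l
  · exact h1 s l u A B h hK hpinch hpole (Or.inr ⟨hi, hj⟩) hreg
  rcases lt_trichotomy (A.1 (Fin.last 0)) 0 with hneg | hzero | hpos
  · by_cases hb : B.1 (Fin.last 0) ≤ 0
    · exact h.good_vtx_pole_low hL hP hK hpinch hpole hi hj hb hreg hS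
    · push Not at hb
      -- `A' < 0 < B'`: cut at the constant `t₀` through the vertex
      set t₀ : ℚ := evq A l with ht₀
      set X : Cf := RebaseZero.mk 0 t₀ with hX
      have hXl : evq X l = t₀ := by rw [hX, evq_mk]; ring
      have hXu : evq X u = t₀ := by rw [hX, evq_mk]; ring
      have hXv : ∀ y : ℝ, ev X y = t₀ := fun y => by rw [hX, ev_mk_zero]
      have hA : ∀ y : ℝ, ev A y = t₀ + A.1 (Fin.last 0) * (y - l) := fun y => by rw [ev_pinch A l]
      have hB : ∀ y : ℝ, ev B y = t₀ + B.1 (Fin.last 0) * (y - l) := fun y => by rw [ev_pinch B l, ← hpinch]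
      have hneg' : (A.1 (Fin.last 0) : ℝ) < 0 := by exact_mod_cast hneg
      have hb' : (0 : ℝ) < B.1 (Fin.last 0) := by exact_mod_cast hb
      refine h.good_cut hadm X (fun y h1 _ => by rw [hA, hXv]; nlinarith) (fun y h1 _ => by rw [hXv, hB]; nlinarith)
        (fun s₁ h₁ => ?_) fun s₃ h₃ => h₃.good_par hP (Or.inl (by rw [hX, mk_fst, hL.ci0]))
      have hu : (l : ℝ) < u := by exact_mod_cast h.lu
      have hregX : evq A u < evq X u := by
        have key : ev A u < ev X u := by rw [hA, hXv]; nlinarith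
        rw [ev_ratCast, ev_ratCast] at key
        exact_mod_cast key
      exact h₁.good_vtx_pole_low hL hP hK (ht₀.symm.trans hXl.symm) hpole hi hj (by rw [hX, mk_fst]) hregX hS
  · exact h.good_par hP (Or.inl (hzero.trans hL.ci0.symm))
  · exact h.good_vtx_pole_up hL hP hK hpinch hpole hi hj hpos hreg

/-- **The pole hypothesis from the two type-S residues.** [Kontsevich–Zagier 2001, §1.2] -/
theorem hPoleLS_of_typeS (hL : LData T a i j ci cj) (hP : HParS T p a i j ci cj) (h1 : HPole1LS T p a i j ci cj)
    (hS : HTypeSLS T p a i j ci cj) : HPoleLS T p a i j ci cj := fun _ _ _ _ _ h hK hpinch hpole hnb hreg =>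
  h.good_vtx_pole hL hP hK hpinch hpole hnb hreg h1 hS

/-- **`HDiff₁` from the two residues**: `IsDN.good_of_HPole` with `hPoleLS_of_typeS` for the datum
and for its base reflection. [Kontsevich–Zagier 2001, §1.2] -/
theorem IsDN.good_of_typeS (h : IsDN s l u A B T p a i j) (hL : LData T a i j ci cj) (h1l : HPole1LS T p a i j ci cj)
    (hSl : HTypeSLS T p a i j ci cj)
    (h1r : HPole1LS (mirT T) (MvPolynomial.C (-1) * p) (mirA a) i j (negS ci) (negS cj))
    (hSr : HTypeSLS (mirT T) (MvPolynomial.C (-1) * p) (mirA a) i j (negS ci) (negS cj)) : Good 2 (KZ.of s) :=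
  h.good_of_HPole hL (hPoleLS_of_typeS hL (RebaseE2.hparS hL) h1l hSl)
    (hPoleLS_of_typeS hL.mirror (RebaseE2.hparS hL.mirror) h1r hSr)

end RebaseE1

/-- **Registered assembly `rebaseSimpleZero_E1ofTypeS`** (part `rebaseSimpleZero_HDiff1_of_HPar1` of
`stub_rebaseSimpleZeroTwo`, line `janus-bands`): a datum of the interval normal form `HDiff₁`
(`RebaseE1.IsDN`, letter data `RebaseE1.LData`) is congruent modulo `KZ.relations` to the subgroup
generated by `GG 0 2 2` as soon as the two residual hypotheses `RebaseE1.HPole1LS` (pinch vertex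
carrying the base pole and exactly one letter) and `RebaseE1.HTypeSLS` (pinch vertex carrying the
base pole and no letter, band between the outer-letter direction below and the horizontal above)
hold for its letter data and for the base-reflected letter data (`RebaseE1.IsDN.good_of_typeS`).
[Kontsevich–Zagier 2001, §1.2, rules (1a), (1b), (2)] -/
theorem rebaseSimpleZero_E1ofTypeS (i j : Fin 2) (s : KZ.IntegralRep (0 + 1 + 2)) (l u : ℚ) (A B ci cj : (Fin (0 + 1) → ℚ) × ℚ) (T : RebaseZero.BData) (p : MvPolynomial (Fin 0) ℚ) (a : Fin 2 → Option ((Fin (0 + 1) → ℚ) × ℚ)) (h : RebaseE1.IsDN s l u A B T p a i j) (hL : RebaseE1.LData T a i j ci cj) (h1l : RebaseE1.HPole1LS T p a i j ci cj) (hSl : RebaseE1.HTypeSLS T p a i j ci cj) (h1r : RebaseE1.HPole1LS (RebaseE1.mirT T) (MvPolynomial.C (-1) * p) (RebaseE1.mirA a) i j (RebaseE1.negS ci) (RebaseE1.negS cj)) (hSr : RebaseE1.HTypeSLS (RebaseE1.mirT T) (MvPolynomial.C (-1) * p) (RebaseE1.mirA a) i j (RebaseE1.negS ci) (RebaseE1.negS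 cj)) : RebaseZero.Good 2 (KZ.of s) :=
  h.good_of_typeS hL h1l hSl h1r hSr

open RebaseZero RebaseNest in
/-- **`HDiff₁` from the two literal residues `HPole1` and `HTypeS`** (literal binders of the
hypothesis `HDiff₁` of `rebaseSimpleZeroTwo_of_intervalGGset`): non-zero base constant, a PINCH at
the left end (`A(l) = B(l) = t₀`) whose vertex carries the base pole (`ℓ₂.2 = l`) and exactly one
letter (`HPole1`), resp. no letter with `λ ≤ A'`, `B' ≤ 0` (`HTypeS`), regular right end.
[Kontsevich–Zagier 2001, §1.2, rules (1a), (1b), (2)] -/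
theorem rebaseSimpleZero_HDiff1_of_HPole1S (HPole1 : ∀ (m : ℕ) (s : KZ.IntegralRep (0 + 1 + 2)) (L : Fin m → (Fin 0 → ℚ) × ℚ) (e : Fin m → ℕ) (p : MvPolynomial (Fin 0) ℚ) (ℓ₁ ℓ₂ : (Fin 0 → ℚ) × ℚ) (a : Fin 2 → Option ((Fin (0 + 1) → ℚ) × ℚ)) (lo hi : Fin 2 → Fin 2 ⊕ ((Fin (0 + 1) → ℚ) × ℚ)) (i j : Fin 2) (A B ci cj : (Fin (0 + 1) → ℚ) × ℚ) (l u : ℚ), i ≠ j → lo i = Sum.inr A → hi i = Sum.inl j → lo j = Sum.inl i → hi j = Sum.inr B → a i = some ci → a j = some cj → ci.1 (Fin.last 0) = 0 → cj.1 (Fin.last 0) ≠ 0 → ((MvPolynomial.coeff 0 p : ℚ) : ℝ) / ∏ k, ((L k).2 : ℝ) ^ e k ≠ 0 → A.1 (Fin.last 0) * l + A.2 = B.1 (Fin.last 0) * l + B.2 → ℓ₂.2 = l → ((ci.2 = A.1 (Fin.last 0) * l + A.2 ∧ cj.1 (Fin.last 0) * l + cj.2 ≠ A.1 (Fin.last 0)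 * l + A.2) ∨ (ci.2 ≠ A.1 (Fin.last 0) * l + A.2 ∧ cj.1 (Fin.last 0) * l + cj.2 = A.1 (Fin.last 0) * l + A.2)) → A.1 (Fin.last 0) * u + A.2 < B.1 (Fin.last 0) * u + B.2 → l < u → (∀ y : ℝ, (l : ℝ) < y → y < (u : ℝ) → RebaseZero.ev A y < RebaseZero.ev B y) → Bornology.IsBounded s.domain → s.domain = SeparatePos.gDom 0 2 2 ![RebaseZero.mk 1 (-l), RebaseZero.mk (-1) u] lo hi → EqOn s.integrand (RebasePos.glit 0 2 p L e ℓ₁ ℓ₂ 0 1 a) s.domain → ∃ c ∈ AddSubgroup.closure (SeparatePos.GGset 0 2 2), KZ.of s - c ∈ KZ.relations) (HTypeS : ∀ (m : ℕ) (s : KZ.IntegralRep (0 + 1 + 2)) (L : Fin m → (Fin 0 → ℚ) × ℚ) (e : Fin m → ℕ) (p : MvPolynomial (Fin 0) ℚ) (ℓ₁ ℓ₂ : (Fin 0 → ℚ) × ℚ) (a : Fin 2 → Option ((Fin (0 + 1) → ℚ) × ℚ)) (lo hi : Fin 2 → Fin 2 ⊕ ((Fin (0 + 1) → ℚ) ×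 ℚ)) (i j : Fin 2) (A B ci cj : (Fin (0 + 1) → ℚ) × ℚ) (l u : ℚ), i ≠ j → lo i = Sum.inr A → hi i = Sum.inl j → lo j = Sum.inl i → hi j = Sum.inr B → a i = some ci → a j = some cj → ci.1 (Fin.last 0) = 0 → cj.1 (Fin.last 0) ≠ 0 → ((MvPolynomial.coeff 0 p : ℚ) : ℝ) / ∏ k, ((L k).2 : ℝ) ^ e k ≠ 0 → A.1 (Fin.last 0) * l + A.2 = B.1 (Fin.last 0) * l + B.2 → ℓ₂.2 = l → ci.2 ≠ A.1 (Fin.last 0) * l + A.2 → cj.1 (Fin.last 0) * l + cj.2 ≠ A.1 (Fin.last 0) * l + A.2 → cj.1 (Fin.last 0) ≤ A.1 (Fin.last 0) → B.1 (Fin.last 0) ≤ 0 → A.1 (Fin.last 0) * u + A.2 < B.1 (Fin.last 0) * u + B.2 → l < u → (∀ y : ℝ, (l : ℝ) < y → y < (u : ℝ) → RebaseZero.ev A y < RebaseZero.ev B y) → Bornology.IsBounded s.domain → s.domain = SeparatePos.gDom 0 2 2 ![RebaseZero.mk 1 (-l), RebaseZero.mk (-1) u] lo hi → EqOn s.integrand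 (RebasePos.glit 0 2 p L e ℓ₁ ℓ₂ 0 1 a) s.domain → ∃ c ∈ AddSubgroup.closure (SeparatePos.GGset 0 2 2), KZ.of s - c ∈ KZ.relations) (m : ℕ) (s : KZ.IntegralRep (0 + 1 + 2)) (L : Fin m → (Fin 0 → ℚ) × ℚ) (e : Fin m → ℕ) (p : MvPolynomial (Fin 0) ℚ) (ℓ₁ ℓ₂ : (Fin 0 → ℚ) × ℚ) (a : Fin 2 → Option ((Fin (0 + 1) → ℚ) × ℚ)) (lo hi : Fin 2 → Fin 2 ⊕ ((Fin (0 + 1) → ℚ) × ℚ)) (i j : Fin 2) (A B ci cj : (Fin (0 + 1) → ℚ) × ℚ) (l u : ℚ) (hij : i ≠ j) (hloi : lo i = Sum.inr A) (hhii : hi i = Sum.inl j) (hloj : lo j = Sum.inl i) (hhij : hi j = Sum.inr B) (hai : a i = some ci) (haj : a j = some cj) (hci : ci.1 (Fin.last 0) = 0) (hcj : cj.1 (Fin.last 0) ≠ 0) (hlu : l < u) (hAB : ∀ y : ℝ, (l : ℝ) < y → y < (u : ℝ) → RebaseZero.ev A y < RebaseZero.ev B y) (hpole : ℓ₂.2 ≤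 l ∨ u ≤ ℓ₂.2) (hbd : Bornology.IsBounded s.domain) (hdom : s.domain = SeparatePos.gDom 0 2 2 ![RebaseZero.mk 1 (-l), RebaseZero.mk (-1) u] lo hi) (hint : EqOn s.integrand (RebasePos.glit 0 2 p L e ℓ₁ ℓ₂ 0 1 a) s.domain) : ∃ c ∈ AddSubgroup.closure (SeparatePos.GGset 0 2 2), KZ.of s - c ∈ KZ.relations := by
  set T : BData := ⟨m, L, e, ℓ₁, ℓ₂, 0, 1⟩ with hT
  have hglit : RebasePos.glit 0 2 p L e ℓ₁ ℓ₂ 0 1 a = glitB T p a := rfl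
  obtain ⟨hlo, hhi⟩ := eq_nlo_nhi hij hloi hhii hloj hhij
  subst hlo hhi
  have hL : RebaseE1.LData T a i j ci cj := ⟨hij, hai, haj, hci, hcj, rfl, rfl⟩
  have hN : RebaseE1.IsDN s l u A B T p a i j := ⟨hij, hdom, hglit ▸ hint, hbd, hlu, hAB, hpole⟩
  have hLm := hL.mirror
  have h1l : RebaseE1.HPole1LS T p a i j ci cj := fun s' l' u' A' B' h' hK hpin hv hone hreg =>
    HPole1 m s' L e p ℓ₁ ℓ₂ a (nlo i A') (nhi j B') i j A' B' ci cj l' u' hij (nlo_self i A') (nhi_of_ne hij B')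
      (nlo_of_ne hij A') (nhi_self j B') hai haj hci hcj hK hpin hv hone hreg h'.lu h'.AB h'.bdd h'.dom h'.int
  have hSl : RebaseE1.HTypeSLS T p a i j ci cj := fun s' l' u' A' B' h' hK hpin hv hi hj hsl hsb hreg =>
    HTypeS m s' L e p ℓ₁ ℓ₂ a (nlo i A') (nhi j B') i j A' B' ci cj l' u' hij (nlo_self i A') (nhi_of_ne hij B')
      (nlo_of_ne hij A') (nhi_self j B') hai haj hci hcj hK hpin hv hi hj hsl hsb hreg h'.lu h'.AB h'.bdd h'.dom h'.int
  have h1r : RebaseE1.HPole1LS (RebaseE1.mirT T) (MvPolynomial.C (-1) * p) (RebaseE1.mirA a) i j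
      (RebaseE1.negS ci) (RebaseE1.negS cj) := fun s' l' u' A' B' h' hK hpin hv hone hreg =>
    HPole1 m s' L e (MvPolynomial.C (-1) * p) ℓ₁ (ℓ₂.1, -ℓ₂.2) (RebaseE1.mirA a) (nlo i A') (nhi j B') i j A' B'
      (RebaseE1.negS ci) (RebaseE1.negS cj) l' u' hij (nlo_self i A') (nhi_of_ne hij B') (nlo_of_ne hij A')
      (nhi_self j B') hLm.hi hLm.hj hLm.ci0 hLm.cj0 hK hpin hv hone hreg h'.lu h'.AB h'.bdd h'.dom h'.int
  have hSr : RebaseE1.HTypeSLS (RebaseE1.mirT T) (MvPolynomial.C (-1) * p) (RebaseE1.mirA a) i j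
      (RebaseE1.negS ci) (RebaseE1.negS cj) := fun s' l' u' A' B' h' hK hpin hv hi hj hsl hsb hreg =>
    HTypeS m s' L e (MvPolynomial.C (-1) * p) ℓ₁ (ℓ₂.1, -ℓ₂.2) (RebaseE1.mirA a) (nlo i A') (nhi j B') i j A' B'
      (RebaseE1.negS ci) (RebaseE1.negS cj) l' u' hij (nlo_self i A') (nhi_of_ne hij B') (nlo_of_ne hij A')
      (nhi_self j B') hLm.hi hLm.hj hLm.ci0 hLm.cj0 hK hpin hv hi hj hsl hsb hreg h'.lu h'.AB h'.bdd h'.dom h'.int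
  exact hN.good_of_typeS hL h1l hSl h1r hSr

/-- **The stub under the two literal residues** (`stub_rebaseSimpleZeroTwo`, line `janus-bands`,
skeleton v11 NARROW format): the rebase of the literal class `GS 0 2` into the subgroup generated by
the rebased class `GG 0 2 2` modulo `KZ.relations`, GIVEN the literal residues `HPole1` and `HTypeS`
of `rebaseSimpleZero_HDiff1_of_HPole1S` (pinch vertices carrying the base pole):
`rebaseSimpleZeroTwo_of_intervalGGset` fed with `rebaseSimpleZero_HDiff1_of_HPole1S`.
[Kontsevich–Zagier 2001, §1.2] -/
theorem rebaseSimpleZeroTwo_of_HPole1S (GS : ℕ → ℕ → Set KZ.FormalRep) (GG : ℕ → ℕ → ℕ → Set KZ.FormalRep) (hGS : ∀ b k, GS b k = {w : KZ.FormalRep | ∃ (m m' n₁ n₂ : ℕ) (s : KZ.IntegralRep (b + 1 + k)) (M : Fin m' → (Fin (b + 1) → ℚ) × ℚ) (L : Fin m → (Fin b → ℚ) × ℚ) (e : Fin m → ℕ) (p : MvPolynomial (Fin b) ℚ) (ℓ₁ ℓ₂ : (Fin b → ℚ) × ℚ) (a : Fin k → Option ((Fin (b + 1) → ℚ) × ℚ))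 (lo hi : Fin k → Fin k ⊕ ((Fin (b + 1) → ℚ) × ℚ)), (n₁ = 0 ∨ n₂ = 0) ∧ n₂ = 1 ∧ Bornology.IsBounded s.domain ∧ s.domain = {z | (∀ j, 0 < ∑ i, ((M j).1 i : ℝ) * z (Fin.castAdd k i) + ((M j).2 : ℝ)) ∧ ∀ i, Sum.elim (fun j => z (Fin.natAdd (b + 1) j)) (fun c => ∑ i', (c.1 i' : ℝ) * z (Fin.castAdd k i') + (c.2 : ℝ)) (lo i) < z (Fin.natAdd (b + 1) i) ∧ z (Fin.natAdd (b + 1) i) < Sum.elim (fun j => z (Fin.natAdd (b + 1) j)) (fun c => ∑ i', (c.1 i' : ℝ) * z (Fin.castAdd k i') + (c.2 : ℝ)) (hi i)} ∧ EqOn s.integrand (fun z => MvPolynomial.aeval (fun i => z (Fin.castAdd k (Fin.castSucc i))) p / (∏ j, (∑ i, ((L j).1 i : ℝ) * z (Fin.castAdd k (Fin.castSucc i)) + ((L j).2 : ℝ)) ^ e j) * ((z (Fin.castAdd k (Fin.last b)) - (∑ i, (ℓ₁.1 i : ℝ) * z (Fin.castAdd k (Fin.castSucc i)) + (ℓ₁.2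 : ℝ))) ^ n₁ / (z (Fin.castAdd k (Fin.last b)) - (∑ i, (ℓ₂.1 i : ℝ) * z (Fin.castAdd k (Fin.castSucc i)) + (ℓ₂.2 : ℝ))) ^ n₂) * ∏ i, (a i).elim 1 (fun c => 1 / (z (Fin.natAdd (b + 1) i) - (∑ i', (c.1 i' : ℝ) * z (Fin.castAdd k i') + (c.2 : ℝ))))) s.domain ∧ w = KZ.of s}) (hGG : ∀ b σ k, GG b σ k = {w : KZ.FormalRep | ∃ (m m' n₁ n₂ : ℕ) (s : KZ.IntegralRep (b + 1 + k)) (M : Fin m' → (Fin (b + 1) → ℚ) × ℚ) (L : Fin m → (Fin b → ℚ) × ℚ) (e : Fin m → ℕ) (p : MvPolynomial (Fin b) ℚ) (ℓ₁ ℓ₂ : (Fin b → ℚ) × ℚ) (a : Fin k → Option ((Fin (b + 1) → ℚ) × ℚ)) (lo hi : Fin k → Fin k ⊕ ((Fin (b + 1) → ℚ) × ℚ)), (n₁ = 0 ∨ n₂ = 0) ∧ (σ = 2 → (∀ i c, a i = some c → c.1 (Fin.last b) = 0) ∧ (∀ i c, (lo i = Sum.inr c ∨ hi i = Sum.inr c)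 → (c.1 (Fin.last b) = 0 ∨ c = (Pi.single (Fin.last b) 1, 0)))) ∧ Bornology.IsBounded s.domain ∧ s.domain = {z | (∀ j, 0 < ∑ i, ((M j).1 i : ℝ) * z (Fin.castAdd k i) + ((M j).2 : ℝ)) ∧ ∀ i, Sum.elim (fun j => z (Fin.natAdd (b + 1) j)) (fun c => ∑ i', (c.1 i' : ℝ) * z (Fin.castAdd k i') + (c.2 : ℝ)) (lo i) < z (Fin.natAdd (b + 1) i) ∧ z (Fin.natAdd (b + 1) i) < Sum.elim (fun j => z (Fin.natAdd (b + 1) j)) (fun c => ∑ i', (c.1 i' : ℝ) * z (Fin.castAdd k i') + (c.2 : ℝ)) (hi i)} ∧ EqOn s.integrand (fun z => MvPolynomial.aeval (fun i => z (Fin.castAdd k (Fin.castSucc i))) p / (∏ j, (∑ i, ((L j).1 i : ℝ) * z (Fin.castAdd k (Fin.castSucc i)) + ((L j).2 : ℝ)) ^ e j) * ((z (Fin.castAdd k (Fin.last b)) - (∑ i, (ℓ₁.1 i : ℝ) * z (Fin.castAdd k (Fin.castSucc i)) + (ℓ₁.2 : ℝ))) ^ n₁ / (z (Fin.castAdd k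 (Fin.last b)) - (∑ i, (ℓ₂.1 i : ℝ) * z (Fin.castAdd k (Fin.castSucc i)) + (ℓ₂.2 : ℝ))) ^ n₂) * ∏ i, (a i).elim 1 (fun c => 1 / (z (Fin.natAdd (b + 1) i) - (∑ i', (c.1 i' : ℝ) * z (Fin.castAdd k i') + (c.2 : ℝ))))) s.domain ∧ w = KZ.of s}) (HPole1 : ∀ (m : ℕ) (s : KZ.IntegralRep (0 + 1 + 2)) (L : Fin m → (Fin 0 → ℚ) × ℚ) (e : Fin m → ℕ) (p : MvPolynomial (Fin 0) ℚ) (ℓ₁ ℓ₂ : (Fin 0 → ℚ) × ℚ) (a : Fin 2 → Option ((Fin (0 + 1) → ℚ) × ℚ)) (lo hi : Fin 2 → Fin 2 ⊕ ((Fin (0 + 1) → ℚ) × ℚ)) (i j : Fin 2) (A B ci cj : (Fin (0 + 1) → ℚ) × ℚ) (l u : ℚ), i ≠ j → lo i = Sum.inr A → hi i = Sum.inl j → lo j = Sum.inl i → hi j = Sum.inr B → a i = some ci → a j = some cj → ci.1 (Fin.last 0) = 0 → cj.1 (Fin.last 0) ≠ 0 → ((MvPolynomial.coeff 0 p : ℚ)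 : ℝ) / ∏ k, ((L k).2 : ℝ) ^ e k ≠ 0 → A.1 (Fin.last 0) * l + A.2 = B.1 (Fin.last 0) * l + B.2 → ℓ₂.2 = l → ((ci.2 = A.1 (Fin.last 0) * l + A.2 ∧ cj.1 (Fin.last 0) * l + cj.2 ≠ A.1 (Fin.last 0) * l + A.2) ∨ (ci.2 ≠ A.1 (Fin.last 0) * l + A.2 ∧ cj.1 (Fin.last 0) * l + cj.2 = A.1 (Fin.last 0) * l + A.2)) → A.1 (Fin.last 0) * u + A.2 < B.1 (Fin.last 0) * u + B.2 → l < u → (∀ y : ℝ, (l : ℝ) < y → y < (u : ℝ) → RebaseZero.ev A y < RebaseZero.ev B y) → Bornology.IsBounded s.domain → s.domain = SeparatePos.gDom 0 2 2 ![RebaseZero.mk 1 (-l), RebaseZero.mk (-1) u] lo hi → EqOn s.integrand (RebasePos.glit 0 2 p L e ℓ₁ ℓ₂ 0 1 a) s.domain → ∃ c ∈ AddSubgroup.closure (SeparatePos.GGset 0 2 2), KZ.of s - c ∈ KZ.relations) (HTypeS : ∀ (m : ℕ) (s : KZ.IntegralRep (0 + 1 + 2)) (L : Fin m → (Fin 0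 → ℚ) × ℚ) (e : Fin m → ℕ) (p : MvPolynomial (Fin 0) ℚ) (ℓ₁ ℓ₂ : (Fin 0 → ℚ) × ℚ) (a : Fin 2 → Option ((Fin (0 + 1) → ℚ) × ℚ)) (lo hi : Fin 2 → Fin 2 ⊕ ((Fin (0 + 1) → ℚ) × ℚ)) (i j : Fin 2) (A B ci cj : (Fin (0 + 1) → ℚ) × ℚ) (l u : ℚ), i ≠ j → lo i = Sum.inr A → hi i = Sum.inl j → lo j = Sum.inl i → hi j = Sum.inr B → a i = some ci → a j = some cj → ci.1 (Fin.last 0) = 0 → cj.1 (Fin.last 0) ≠ 0 → ((MvPolynomial.coeff 0 p : ℚ) : ℝ) / ∏ k, ((L k).2 : ℝ) ^ e k ≠ 0 → A.1 (Fin.last 0) * l + A.2 = B.1 (Fin.last 0) * l + B.2 → ℓ₂.2 = l → ci.2 ≠ A.1 (Fin.last 0) * l + A.2 → cj.1 (Fin.last 0) * l + cj.2 ≠ A.1 (Fin.last 0) * l + A.2 → cj.1 (Fin.last 0) ≤ A.1 (Fin.last 0) → B.1 (Fin.last 0) ≤ 0 → A.1 (Fin.last 0) * u + A.2 < B.1 (Fin.last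 0) * u + B.2 → l < u → (∀ y : ℝ, (l : ℝ) < y → y < (u : ℝ) → RebaseZero.ev A y < RebaseZero.ev B y) → Bornology.IsBounded s.domain → s.domain = SeparatePos.gDom 0 2 2 ![RebaseZero.mk 1 (-l), RebaseZero.mk (-1) u] lo hi → EqOn s.integrand (RebasePos.glit 0 2 p L e ℓ₁ ℓ₂ 0 1 a) s.domain → ∃ c ∈ AddSubgroup.closure (SeparatePos.GGset 0 2 2), KZ.of s - c ∈ KZ.relations) : ∀ x ∈ GS 0 2, ∃ c ∈ AddSubgroup.closure (GG 0 2 2), x - c ∈ KZ.relations := by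
  intro x hx
  rw [hGS] at hx
  obtain ⟨m, m', n₁, n₂, s, M, L, e, p, ℓ₁, ℓ₂, a, lo, hi, h12, hn, hbd, hdom, hint, rfl⟩ := hx
  rw [hGG]
  exact rebaseSimpleZeroTwo_of_intervalGGset (rebaseSimpleZero_HDiff1_of_HPole1S HPole1 HTypeS) m m' n₁ n₂ s M L e
    p ℓ₁ ℓ₂ a lo hi h12 hn hbd hdom hint

end Summit.KontsevichZagierPeriods.ArrangementNormalForm.JanusBands
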